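import Literature.NumberTheory.LFunctions.YoshidaWindowGramMiddleJBox
import HarnessLib

/-!
# Format C kit: column-CHUNKED evaluation of the odd middle-moment boxes (kernel-budget plumbing)

Helper file (`--supports stmt-RiemannHypothesis-18085`; parity-ladder L-sides past `a = 1`), RH-free, no numerics content.
Prover B g21 of unit `sr-gb-rung-b`.

The odd middle-moment record of a format-C λ-rung is re-verified in the kernel by `decide` on
`momO.<blk> = (midMomO S C ctab cv v B₃ K J).<blk>` (generator of rh-explicit-weil-2).  Each entry of a block is a
`sumBox` over the `K` middle columns whose summands read the light column table by random access
(`tget ctab (B₃ + t + 1)` = a list walk of length `B₃ + t`), so one block costs `≍ J²·K·(B₃ + K/2)` kernel steps: at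
`K = 1536` middle columns (cell-14 runs `O103M` / `O1035`, hp precision) one block exceeds the kernel's memory ceiling
(`(kernel) excessive memory consumption detected`) and even one entry exceeds the gate's 600-s cap.  The boxes are
EXACT integer-interval sums (`MI.add` adds endpoints), so the column range splits additively; this file provides the
split identities, with every index written as a numeral parameter tied by an equation so that `rw` applies them to
literal statements:

* `sumBox_add` — `sumBox S f (K₁ + K₂) = (sumBox S f K₁).add (sumBox S (fun t ↦ f (K₁ + t)) K₂)`;
* `hmAAoBox_split` / `hmABoBox_split` / `hmBAoBox_split` — the three `ctab`-reading blocks over `[B₃, B₃ + K)` with weights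
  `w.drop D` split at `K₁` into the chunk `[B₃, B₃ + K₁)` plus the same box over `[B₃', B₃' + K₂)`, `B₃' = B₃ + K₁`, weights `w.drop D'`,
  `D' = D + K₁`;
* `getMI_tabJ_eq` — reading an entry of `tabJ` (the Literature lemma is private), and the projections `midMomO_AA/AB/BA`.

With these, a rung proves per-chunk kernel facts (256 columns each) and assembles the generator's entry / block statements
by `rw` only.  Standard axioms; nothing about Weil's form is asserted here.
-/

set_option linter.dupNamespace false

namespace Summit.RiemannHypothesis.RiemannHypothesis.Theorems.WeilFormatC

open Literature.NumberTheory.LFunctions Literature.NumberTheory.LFunctions.Yoshida1992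
open Literature.NumberTheory.LFunctions.Yoshida1992.Encl Literature.Analysis.ValidatedNumerics.NumericsMP

/-- `MI.add` is associative (exact endpoint addition). [folklore] -/
theorem MI_add_add (I J L : MI) : (I.add J).add L = I.add (J.add L) := by
  simp only [MI.add, add_assoc]

/-- `sumBox` over `K₁ + K₂` summands splits into the first `K₁` and the shifted remaining `K₂`. [folklore] -/
theorem sumBox_add (S : ℕ) (f : ℕ → MI) (K₁ K₂ : ℕ) :
    sumBox S f (K₁ + K₂) = (sumBox S f K₁).add (sumBox S (fun t ↦ f (K₁ + t)) K₂) := by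
  induction K₂ with
  | zero =>
      show sumBox S f K₁ = (sumBox S f K₁).add (MI.ofInt S 0)
      simp only [MI.add, MI.ofInt, zero_mul, add_zero]
  | succ n ih =>
      show (sumBox S f (K₁ + n)).add (f (K₁ + n)) = (sumBox S f K₁).add ((sumBox S (fun t ↦ f (K₁ + t)) n).add (f (K₁ + n)))
      rw [ih, MI_add_add]

/-- Reading the shifted weight list: `(w.drop D').getD t 0 = (w.drop D).getD (K₁ + t) 0` when `D' = D + K₁`. [folklore] -/
theorem getD_drop_shift (w : List ℕ) {D D' K₁ : ℕ} (hD : D + K₁ = D') (t : ℕ) :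
    (w.drop D').getD t 0 = (w.drop D).getD (K₁ + t) 0 := by
  subst hD
  simp only [List.getD_eq_getElem?_getD, List.getElem?_drop, Nat.add_assoc]

/-- **Column split of the `AA` middle-moment box.**  [folklore] -/
theorem hmAAoBox_split (S : ℕ) (C : Consts) (ctab : List IdxRec) (cv : ℕ) (w : List ℕ)
    (D B₃ K₁ K₂ K B₃' D' : ℕ) (hK : K₁ + K₂ = K) (hB : B₃ + K₁ = B₃') (hD : D + K₁ = D') (j j' : ℕ) :
    hmAAoBox S C ctab cv (w.drop D) B₃ K j j' =
      (hmAAoBox S C ctab cv (w.drop D) B₃ K₁ j j').add (hmAAoBox S C ctab cv (w.drop D') B₃' K₂ j j') := by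
  subst hK hB
  unfold hmAAoBox
  rw [sumBox_add]
  congr 1
  congr 1
  funext t
  rw [getD_drop_shift w hD t, show B₃ + (K₁ + t) = B₃ + K₁ + t from (Nat.add_assoc _ _ _).symm]

/-- **Column split of the `AB` middle-moment box.**  [folklore] -/
theorem hmABoBox_split (S : ℕ) (C : Consts) (ctab : List IdxRec) (cv : ℕ) (w : List ℕ)
    (D B₃ K₁ K₂ K B₃' D' : ℕ) (hK : K₁ + K₂ = K) (hB : B₃ + K₁ = B₃') (hD : D + K₁ = D') (j r' : ℕ) :
    hmABoBox S C ctab cv (w.drop D) B₃ K j r' =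
      (hmABoBox S C ctab cv (w.drop D) B₃ K₁ j r').add (hmABoBox S C ctab cv (w.drop D') B₃' K₂ j r') := by
  subst hK hB
  unfold hmABoBox
  rw [sumBox_add]
  congr 1
  congr 1
  funext t
  rw [getD_drop_shift w hD t, show B₃ + (K₁ + t) = B₃ + K₁ + t from (Nat.add_assoc _ _ _).symm]

/-- **Column split of the `BA` middle-moment box.**  [folklore] -/
theorem hmBAoBox_split (S : ℕ) (C : Consts) (ctab : List IdxRec) (cv : ℕ) (w : List ℕ)
    (D B₃ K₁ K₂ K B₃' D' : ℕ) (hK : K₁ + K₂ = K) (hB : B₃ + K₁ = B₃') (hD : D + K₁ = D') (r' j : ℕ) :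
    hmBAoBox S C ctab cv (w.drop D) B₃ K r' j =
      (hmBAoBox S C ctab cv (w.drop D) B₃ K₁ r' j).add (hmBAoBox S C ctab cv (w.drop D') B₃' K₂ r' j) := by
  subst hK hB
  unfold hmBAoBox
  rw [sumBox_add]
  congr 1
  congr 1
  funext t
  rw [getD_drop_shift w hD t, show B₃ + (K₁ + t) = B₃ + K₁ + t from (Nat.add_assoc _ _ _).symm]

/-- Reading an entry of `tabJ J f` inside the range. [folklore] -/
theorem getMI_tabJ_eq {J : ℕ} (f : ℕ → ℕ → MI) {x y : ℕ} (hx : x < J) (hy : y < J) : getMI (tabJ J f) x y = f x y := by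
  unfold getMI tabJ
  simp only [List.getD_eq_getElem?_getD, List.getElem?_map, List.getElem?_range hx, List.getElem?_range hy, Option.map_some,
    Option.getD_some]

/-- The `AA` block of the computed odd moment record. [folklore] -/
theorem midMomO_AA (S : ℕ) (C : Consts) (ctab : List IdxRec) (cv : ℕ) (v : List ℕ) (B₃ K J : ℕ) :
    (midMomO S C ctab cv v B₃ K J).AA = tabJ J (hmAAoBox S C ctab cv v B₃ K) := rfl

/-- The `AB` block of the computed odd moment record. [folklore] -/
theorem midMomO_AB (S : ℕ) (C : Consts) (ctab : List IdxRec) (cv : ℕ) (v : List ℕ) (B₃ K J : ℕ) :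
    (midMomO S C ctab cv v B₃ K J).AB = tabJ J (hmABoBox S C ctab cv v B₃ K) := rfl

/-- The `BA` block of the computed odd moment record. [folklore] -/
theorem midMomO_BA (S : ℕ) (C : Consts) (ctab : List IdxRec) (cv : ℕ) (v : List ℕ) (B₃ K J : ℕ) :
    (midMomO S C ctab cv v B₃ K J).BA = tabJ J (hmBAoBox S C ctab cv v B₃ K) := rfl

/-- Entry `(x, y)` of the `AA` block of the computed record is the `AA` box. [folklore] -/
theorem getMI_midMomO_AA (S : ℕ) (C : Consts) (ctab : List IdxRec) (cv : ℕ) (v : List ℕ) (B₃ K J : ℕ) {x y : ℕ}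
    (hx : x < J) (hy : y < J) : getMI (midMomO S C ctab cv v B₃ K J).AA x y = hmAAoBox S C ctab cv v B₃ K x y := by
  rw [midMomO_AA, getMI_tabJ_eq _ hx hy]

/-- Entry `(x, y)` of the `AB` block of the computed record is the `AB` box. [folklore] -/
theorem getMI_midMomO_AB (S : ℕ) (C : Consts) (ctab : List IdxRec) (cv : ℕ) (v : List ℕ) (B₃ K J : ℕ) {x y : ℕ}
    (hx : x < J) (hy : y < J) : getMI (midMomO S C ctab cv v B₃ K J).AB x y = hmABoBox S C ctab cv v B₃ K x y := by
  rw [midMomO_AB, getMI_tabJ_eq _ hx hy]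

/-- Entry `(x, y)` of the `BA` block of the computed record is the `BA` box. [folklore] -/
theorem getMI_midMomO_BA (S : ℕ) (C : Consts) (ctab : List IdxRec) (cv : ℕ) (v : List ℕ) (B₃ K J : ℕ) {x y : ℕ}
    (hx : x < J) (hy : y < J) : getMI (midMomO S C ctab cv v B₃ K J).BA x y = hmBAoBox S C ctab cv v B₃ K x y := by
  rw [midMomO_BA, getMI_tabJ_eq _ hx hy]

end Summit.RiemannHypothesis.RiemannHypothesis.Theorems.WeilFormatC
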